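import Mathlib
import HarnessLib
import Summits.HubbardSuperconductivity.HubbardSuperconductivity.Theorems.KLProgrammeKLRegimeVolumeLimitPerSiteDoors

/-!
# VL children in HAMILTONIAN currency: the child closes from the thermodynamic limit of the torus GIBBS STATE of the Hubbard model at
# finitely many local observables — the density and the Matsubara coefficients of ONE two-time pair function at fixed lattice offsets
# (seat hubbard-kl-k3c5-p3 g7, technique «OS-positivity-free direct assembly»; `--supports` the VL child stmt-HubbardSuperconductivity-20239)

Route `KLProgramme`, crux K3 `KLRegimeTwoPointLimit`, child VOLUME-LIMIT (`VolumeLimitP2 Pr FinalTwoLegVolLimitEx W`; gen 6 stmt-…-20239).  The per-site door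
`volumeLimitP2_of_perSiteLimitText` (…VolumeLimitPerSiteDoors, p519944) closes the child from the convergence, for each Matsubara integer `n` and lattice
offset `z`, of the site-kernel value `h_L(n,z) = torusFourierInv (Σ∞⁰_L(n,·)) (Torus.proj L z)` of the cutoff-free bare carrier.  By (H1) (k3c5-p1,
`klSixInf_eq_neg_shiftedDressedMatsubara`) and the character bookkeeping `torusFourierInv_shiftedDressedMatsubara_eq` (p515940) that value is

  `h_L(n,z) = U·(⟨c†_{0↓}c_{0↓}⟩_{β,L} − ½)·[z = 0] − U²·L⁻²·Σ_x 𝒫_L(n; x, x + z)`,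
  `𝒫_L(n; x, y) = ∫₀^β e^{iω_n τ} ⟨τ_τ(A_x)·A_y†⟩_{β, H_L} dτ`,  `A_x = c_{x↑} n_{x↓} − ½ c_{x↑}`,  `H_L = hubbardTorusWith 2 L 1 U (μ + U/2)`,

and TRANSLATION INVARIANCE of the torus Gibbs state ([tree] `gibbsState_relabel`, `relabel_translate_hubbardTorusWith`) makes the volume average the single
pair function `𝒫_L(n; 0, z)`.  Hence (§4) the VL child of ANY generation closes from two families of plain limits of torus-Gibbs expectations of LOCAL
observables — no Grassmann object, no norm, no rate, no uniformity:

  (G-dens) `⟨c†_{0↓}c_{0↓}⟩_{β, U, μ+U/2, L}` converges as `L → ∞`;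
  (G-pair) for each `n : ℤ` and `z : ℤ²`, `𝒫_L(n; 0, proj_L z)` converges as `L → ∞` (ε-form).

This is the «local Gibbs convergence» residual named in this seat's g6 analysis (the two-volume content of K3's child 5 IS the thermodynamic limit of the
positive-temperature Gibbs state on these observables — expansion content in the KL regime, supplied by the engine lineage).

* §1 `relabel_translate_exp`, `relabel_translate_imagTimeEvolve`, `relabel_translate_dressedMode`, `dressedPair_translate` — translation covariance
  of the two-time pair function;
* §2 `siteKernel_eq_gibbs` — the displayed identity for `L ≥ 3`, `U ≠ 0`, `β > 0`;
* §3 `perSite_limit_of_gibbs_limits` — (G-dens) + (G-pair at (n,z)) ⇒ the per-site limit of `h_L(n,z)`;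
* §4 **`volumeLimitP2_of_gibbsLimitText (Pr W)`** (the gen-6 by-workitem closer `KLRegimeVolumeLimitV16_of_gibbsLimitText` is the thin sequel
  …VolumeLimitV16GibbsCloser, kept apart so that this file stays outside the route file's import cone).

Everything is proved; no definition; nothing is asserted about the model.
-/

noncomputable section

namespace Summit.HubbardSuperconductivity.HubbardSuperconductivity.Theorems.TwoPointAssembly

set_option linter.dupNamespace false -- summit = problem name (single-conjunct summit), D-0017

open scoped ComplexConjugate
open Matrix Complex Finset Filter Topology Literature.MathematicalPhysics.QuantumLattice Literature.Probability.LatticeModels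
open Literature.MathematicalPhysics.QuantumLattice.FermiRG
open Summit.HubbardSuperconductivity.HubbardSuperconductivity.Theorems.DispersionFlow
open Summit.HubbardSuperconductivity.HubbardSuperconductivity.Theorems.KLRegimeSplit
open Summit.HubbardSuperconductivity.HubbardSuperconductivity.Theorems.KLProgrammeLegKernels

/-! ## §1 Translation covariance of the two-time dressed pair function on the torus -/

section Translate

variable {L : ℕ} [NeZero L]

/-- `relabel` by a torus translation commutes with the matrix exponential (the tree's `relabel_exp`, re-keyed to the instance paths of the concrete
torus Fock space by `convert`). [folklore] -/
theorem relabel_translate_exp (v : TorusSite 2 L) (X : Matrix (Finset (Orb (FermionTorus 2 L))) (Finset (Orb (FermionTorus 2 L))) ℂ) :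
    relabel (Orb.translate v) (NormedSpace.exp X) = NormedSpace.exp (relabel (Orb.translate v) X) := by
  convert relabel_exp (Orb.translate v) X using 4

/-- `relabel` by a torus translation commutes with the imaginary-time evolution: `T_v(e^{sH}Xe^{−sH}) = e^{s·T_vH}(T_vX)e^{−s·T_vH}`. [folklore] -/
theorem relabel_translate_imagTimeEvolve (v : TorusSite 2 L) (H X : Matrix (Finset (Orb (FermionTorus 2 L))) (Finset (Orb (FermionTorus 2 L))) ℂ)
    (s : ℂ) : relabel (Orb.translate v) (imagTimeEvolve H s X) = imagTimeEvolve (relabel (Orb.translate v) H) s (relabel (Orb.translate v) X) := by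
  simp only [imagTimeEvolve_eq, ← neg_smul, relabel_mul, relabel_translate_exp, relabel_smul]

/-- The single-site dressed mode `A_x = c_{x↑}n_{x↓} − ½c_{x↑}` translates to `A_{x+v}`. [folklore] -/
theorem relabel_translate_dressedMode (v x : TorusSite 2 L) :
    relabel (Orb.translate v)
        (annihilation (orb (FermionTorus.ofTorusSite x) 0) * numberOp (FermionTorus.ofTorusSite x) 1 -
          (1 / 2 : ℂ) • annihilation (orb (FermionTorus.ofTorusSite x) 0)) =
      annihilation (orb (FermionTorus.ofTorusSite (x + v)) 0) * numberOp (FermionTorus.ofTorusSite (x + v)) 1 -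
        (1 / 2 : ℂ) • annihilation (orb (FermionTorus.ofTorusSite (x + v)) 0) := by
  rw [relabel_sub, relabel_mul, relabel_smul, relabel_annihilation, Orb.translate_orb, relabel_translate_numberOp]

/-- **Translation covariance**: `⟨τ_τ(A_x) A_y†⟩_{β,H_L} = ⟨τ_τ(A_{x+v}) A_{y+v}†⟩_{β,H_L}` for the Hubbard torus Hamiltonian `H_L = hubbardTorusWith 2 L 1 U μ`
(`gibbsState_relabel` with the translation `Orb.translate v`, under which `H_L` is invariant). -/
theorem dressedPair_translate (U μ β : ℝ) (τ : ℂ) (x y v : TorusSite 2 L) :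
    gibbsState β (hubbardTorusWith 2 L 1 U μ)
        (imagTimeEvolve (hubbardTorusWith 2 L 1 U μ) τ
            (annihilation (orb (FermionTorus.ofTorusSite x) 0) * numberOp (FermionTorus.ofTorusSite x) 1 -
              (1 / 2 : ℂ) • annihilation (orb (FermionTorus.ofTorusSite x) 0)) *
          (annihilation (orb (FermionTorus.ofTorusSite y) 0) * numberOp (FermionTorus.ofTorusSite y) 1 -
              (1 / 2 : ℂ) • annihilation (orb (FermionTorus.ofTorusSite y) 0))ᴴ) =
      gibbsState β (hubbardTorusWith 2 L 1 U μ)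
        (imagTimeEvolve (hubbardTorusWith 2 L 1 U μ) τ
            (annihilation (orb (FermionTorus.ofTorusSite (x + v)) 0) * numberOp (FermionTorus.ofTorusSite (x + v)) 1 -
              (1 / 2 : ℂ) • annihilation (orb (FermionTorus.ofTorusSite (x + v)) 0)) *
          (annihilation (orb (FermionTorus.ofTorusSite (y + v)) 0) * numberOp (FermionTorus.ofTorusSite (y + v)) 1 -
              (1 / 2 : ℂ) • annihilation (orb (FermionTorus.ofTorusSite (y + v)) 0))ᴴ) := by
  have key := gibbsState_relabel (Orb.translate v) β (hubbardTorusWith 2 L 1 U μ)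
    (imagTimeEvolve (hubbardTorusWith 2 L 1 U μ) τ
        (annihilation (orb (FermionTorus.ofTorusSite x) 0) * numberOp (FermionTorus.ofTorusSite x) 1 -
          (1 / 2 : ℂ) • annihilation (orb (FermionTorus.ofTorusSite x) 0)) *
      (annihilation (orb (FermionTorus.ofTorusSite y) 0) * numberOp (FermionTorus.ofTorusSite y) 1 -
          (1 / 2 : ℂ) • annihilation (orb (FermionTorus.ofTorusSite y) 0))ᴴ)
  simp only [relabel_mul, relabel_translate_imagTimeEvolve, relabel_translate_hubbardTorusWith, relabel_conjTranspose,
    relabel_translate_dressedMode] at key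
  convert key.symm using 3

end Translate

/-! ## §2 The site kernel of the bare carrier in Gibbs currency -/

section Gibbs

variable {L : ℕ} [NeZero L]

/-- **`h_L(n,y) = U·occ∞(L)·[y = 0] − U²·𝒫_L(n; 0, y)`**: the site kernel of the cutoff-free bare carrier at the Matsubara integer `n` and the torus site
`y` is the Hartree term at the origin minus `U²` times the Matsubara coefficient of the single-site dressed pair function between the origin and `y`
(`L ≥ 3`, `U ≠ 0`, `β > 0`; (H1) + character orthogonality + translation covariance). -/
theorem siteKernel_eq_gibbs (hL : 3 ≤ L) {β : ℝ} (hβ : 0 < β) {U : ℝ} (hU : U ≠ 0) (μ : ℝ) (n : ℤ)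
    (y : TorusSite 2 L) :
    torusFourierInv (fun p : TorusSite 2 L => klSelfEnergyInf L β U μ 0 n p) y =
      (if y = 0 then (U : ℂ) * klOccInf L β U μ else 0) -
        (U : ℂ) ^ 2 * ∫ τ in (0 : ℝ)..β, cexp (I * ((Real.pi * (2 * (n : ℝ) + 1) / β : ℝ) : ℂ) * τ) *
          gibbsState β (hubbardTorusWith 2 L 1 U (μ + U / 2))
            (imagTimeEvolve (hubbardTorusWith 2 L 1 U (μ + U / 2)) (τ : ℂ)
              (annihilation (orb (FermionTorus.ofTorusSite (0 : TorusSite 2 L)) 0) * numberOp (FermionTorus.ofTorusSite (0 : TorusSite 2 L)) 1 -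
                (1 / 2 : ℂ) • annihilation (orb (FermionTorus.ofTorusSite (0 : TorusSite 2 L)) 0)) *
              (annihilation (orb (FermionTorus.ofTorusSite y) 0) * numberOp (FermionTorus.ofTorusSite y) 1 -
                (1 / 2 : ℂ) • annihilation (orb (FermionTorus.ofTorusSite y) 0))ᴴ) := by
  -- translation covariance under the integral: `⟨τ_τ(A_x) A_{x+y}†⟩ = ⟨τ_τ(A_0) A_y†⟩`
  have hτ : ∀ (x : TorusSite 2 L) (τ : ℝ),
      gibbsState β (hubbardTorusWith 2 L 1 U (μ + U / 2))
          (imagTimeEvolve (hubbardTorusWith 2 L 1 U (μ + U / 2)) (τ : ℂ)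
              (annihilation (orb (FermionTorus.ofTorusSite x) 0) * numberOp (FermionTorus.ofTorusSite x) 1 -
                (1 / 2 : ℂ) • annihilation (orb (FermionTorus.ofTorusSite x) 0)) *
            (annihilation (orb (FermionTorus.ofTorusSite (x + y)) 0) * numberOp (FermionTorus.ofTorusSite (x + y)) 1 -
                (1 / 2 : ℂ) • annihilation (orb (FermionTorus.ofTorusSite (x + y)) 0))ᴴ) =
        gibbsState β (hubbardTorusWith 2 L 1 U (μ + U / 2))
          (imagTimeEvolve (hubbardTorusWith 2 L 1 U (μ + U / 2)) (τ : ℂ)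
              (annihilation (orb (FermionTorus.ofTorusSite (0 : TorusSite 2 L)) 0) * numberOp (FermionTorus.ofTorusSite (0 : TorusSite 2 L)) 1 -
                (1 / 2 : ℂ) • annihilation (orb (FermionTorus.ofTorusSite (0 : TorusSite 2 L)) 0)) *
            (annihilation (orb (FermionTorus.ofTorusSite y) 0) * numberOp (FermionTorus.ofTorusSite y) 1 -
                (1 / 2 : ℂ) • annihilation (orb (FermionTorus.ofTorusSite y) 0))ᴴ) := by
    intro x τ
    have h := dressedPair_translate (L := L) U (μ + U / 2) β (τ : ℂ) 0 y x
    rw [zero_add, add_comm y x] at h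
    exact h.symm
  -- (H1) and the Fourier bookkeeping
  have hfun : (fun p : TorusSite 2 L => klSelfEnergyInf L β U μ 0 n p) =
      fun p : TorusSite 2 L => (U : ℂ) * klOccInf L β U μ + (U : ℂ) ^ 2 * klSixInf L β U μ n p :=
    funext fun p => klSelfEnergyInf_zero_frame hβ.ne' U μ n p
  have hsix : (fun p : TorusSite 2 L => klSixInf L β U μ n p) = fun p : TorusSite 2 L =>
      -(∫ τ in (0 : ℝ)..β, cexp (I * ((Real.pi * (2 * (n : ℝ) + 1) / β : ℝ) : ℂ) * τ) *
        gibbsState β (hubbardTorusWith 2 L 1 U (μ + U / 2))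
          (imagTimeEvolve (hubbardTorusWith 2 L 1 U (μ + U / 2)) (τ : ℂ)
            ((∑ z : FermionTorus 2 L, (torusFourierWeight 2 L * torusChar (-p) z.toTorusSite) • (numberOp z 1 * creation (orb z 0)))ᴴ -
              (1 / 2 : ℂ) • momentumAnnihilation (-p) 0) *
            ((∑ z : FermionTorus 2 L, (torusFourierWeight 2 L * torusChar (-p) z.toTorusSite) • (numberOp z 1 * creation (orb z 0)))ᴴ -
              (1 / 2 : ℂ) • momentumAnnihilation (-p) 0)ᴴ)) :=
    funext fun p => klSixInf_eq_neg_shiftedDressedMatsubara hL hβ hU μ n p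
  have hcard : (Fintype.card (TorusSite 2 L) : ℂ) = (L : ℂ) ^ 2 := by
    rw [Fintype.card_fun, ZMod.card, Fintype.card_fin]; push_cast; ring
  have havg : torusFourierInv (fun p : TorusSite 2 L => klSixInf L β U μ n p) y =
      -(∫ τ in (0 : ℝ)..β, cexp (I * ((Real.pi * (2 * (n : ℝ) + 1) / β : ℝ) : ℂ) * τ) *
          gibbsState β (hubbardTorusWith 2 L 1 U (μ + U / 2))
            (imagTimeEvolve (hubbardTorusWith 2 L 1 U (μ + U / 2)) (τ : ℂ)
              (annihilation (orb (FermionTorus.ofTorusSite (0 : TorusSite 2 L)) 0) * numberOp (FermionTorus.ofTorusSite (0 : TorusSite 2 L)) 1 -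
                (1 / 2 : ℂ) • annihilation (orb (FermionTorus.ofTorusSite (0 : TorusSite 2 L)) 0)) *
              (annihilation (orb (FermionTorus.ofTorusSite y) 0) * numberOp (FermionTorus.ofTorusSite y) 1 -
                (1 / 2 : ℂ) • annihilation (orb (FermionTorus.ofTorusSite y) 0))ᴴ)) := by
    rw [hsix, torusFourierInv_neg', torusFourierInv_shiftedDressedMatsubara_eq U (μ + U / 2) β (Real.pi * (2 * (n : ℝ) + 1) / β) y]
    simp_rw [hτ]
    rw [Finset.sum_const, Finset.card_univ, nsmul_eq_mul, hcard, ← mul_assoc, torusFourierWeight_mul_self_mul_pow, one_mul]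
  have e1 : torusFourierInv (fun p : TorusSite 2 L => klSelfEnergyInf L β U μ 0 n p) y =
      torusFourierInv (fun _ : TorusSite 2 L => (U : ℂ) * klOccInf L β U μ) y + (U : ℂ) ^ 2 * torusFourierInv (fun p : TorusSite 2 L => klSixInf L β U μ n p) y := by
    rw [hfun]; exact torusFourierInv_const_add_mul _ _ _ _
  rw [e1, torusFourierInv_const', havg, mul_neg, ← sub_eq_add_neg]

end Gibbs

/-! ## §3 Per-site limits from Gibbs limits -/

/-- **(G-dens) + (G-pair at `(n,z)`) ⇒ the per-site limit of `h_L(n,z)`** (every real `U ≠ 0`, `β > 0`): if the density `⟨c†_{0↓}c_{0↓}⟩_{β,L}` converges and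
the Matsubara coefficient `𝒫_L(n; 0, proj_L z)` converges (ε-forms), then `torusFourierInv (Σ∞⁰_L(n,·)) (Torus.proj L z)` converges. -/
theorem perSite_limit_of_gibbs_limits {β U : ℝ} (hβ : 0 < β) (hU : U ≠ 0) (μ : ℝ) (n : ℤ) (z : Site 2)
    (hd : ∃ d : ℂ, ∀ ε > (0 : ℝ), ∃ L₁ : ℕ, ∀ (L : ℕ) [NeZero L], L₁ ≤ L →
      ‖hubbardThermalTwoPoint β U (μ + U / 2) L 0 0 1 1 - d‖ ≤ ε)
    (hp : ∃ h : ℂ, ∀ ε > (0 : ℝ), ∃ L₁ : ℕ, ∀ (L : ℕ) [NeZero L], L₁ ≤ L →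
      ‖(∫ τ in (0 : ℝ)..β, cexp (I * ((Real.pi * (2 * (n : ℝ) + 1) / β : ℝ) : ℂ) * τ) *
          gibbsState β (hubbardTorusWith 2 L 1 U (μ + U / 2))
            (imagTimeEvolve (hubbardTorusWith 2 L 1 U (μ + U / 2)) (τ : ℂ)
              (annihilation (orb (FermionTorus.ofTorusSite (0 : TorusSite 2 L)) 0) * numberOp (FermionTorus.ofTorusSite (0 : TorusSite 2 L)) 1 -
                (1 / 2 : ℂ) • annihilation (orb (FermionTorus.ofTorusSite (0 : TorusSite 2 L)) 0)) *
              (annihilation (orb (FermionTorus.ofTorusSite (Torus.proj L z)) 0) * numberOp (FermionTorus.ofTorusSite (Torus.proj L z)) 1 -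
                (1 / 2 : ℂ) • annihilation (orb (FermionTorus.ofTorusSite (Torus.proj L z)) 0))ᴴ)) - h‖ ≤ ε) :
    ∃ hlim : ℂ, ∀ ε > (0 : ℝ), ∃ L₁ : ℕ, ∀ (L : ℕ) [NeZero L], L₁ ≤ L →
      ‖torusFourierInv (fun p : TorusSite 2 L => klSelfEnergyInf L β U μ 0 n p) (Torus.proj L z) - hlim‖ ≤ ε := by
  classical
  obtain ⟨d, hd⟩ := hd
  obtain ⟨h, hp⟩ := hp
  -- beyond `2‖z‖∞` the indicator `[proj_L z = 0]` is the constant `[z = 0]`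
  set R : ℕ := Site.supNorm z with hR
  have hzbox : z ∈ box 2 R := mem_box_iff_supNorm_le.2 le_rfl
  refine ⟨(if z = 0 then (U : ℂ) * (d - 1 / 2) else 0) - (U : ℂ) ^ 2 * h, fun ε hε => ?_⟩
  have hU1 : (0 : ℝ) < |U| + 1 := by positivity
  obtain ⟨L₁, hL₁⟩ := hd (ε / (2 * (|U| + 1))) (by positivity)
  obtain ⟨L₂, hL₂⟩ := hp (ε / (2 * (U ^ 2 + 1))) (by positivity)
  refine ⟨max (max L₁ L₂) (max 3 (2 * R + 1)), fun L _ hL => ?_⟩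
  have hL3 : 3 ≤ L := (le_max_left _ _).trans ((le_max_right _ _).trans hL)
  have h2R : 2 * R < L := lt_of_lt_of_le (Nat.lt_succ_self _) ((le_max_right _ _).trans ((le_max_right _ _).trans hL))
  have hind : (Torus.proj L z = 0) ↔ (z = 0) := by
    constructor
    · intro h0
      have hz0 : (0 : Site 2) ∈ box 2 R := by rw [mem_box]; intro i; simp
      have hp0 : Torus.proj L (0 : Site 2) = 0 := by funext i; simp [Torus.proj_apply]
      exact proj_injOn_box h2R z hzbox 0 hz0 (h0.trans hp0.symm)
    · rintro rfl; funext i; simp [Torus.proj_apply]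
  rw [siteKernel_eq_gibbs hL3 hβ hU μ n (Torus.proj L z)]
  have hdL := hL₁ L ((le_max_left _ _).trans ((le_max_left _ _).trans hL))
  have hpL := hL₂ L ((le_max_right _ _).trans ((le_max_left _ _).trans hL))
  -- Hartree part
  have hH : ‖(if Torus.proj L z = 0 then (U : ℂ) * klOccInf L β U μ else 0) - (if z = 0 then (U : ℂ) * (d - 1 / 2) else 0)‖ ≤ ε / 2 := by
    by_cases hz : z = 0
    · rw [if_pos (hind.2 hz), if_pos hz, ← mul_sub, norm_mul, Complex.norm_real, Real.norm_eq_abs, klOccInf]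
      have hsub : hubbardThermalTwoPoint β U (μ + U / 2) L 0 0 1 1 - 1 / 2 - (d - 1 / 2) =
          hubbardThermalTwoPoint β U (μ + U / 2) L 0 0 1 1 - d := by ring
      rw [hsub]
      calc |U| * ‖hubbardThermalTwoPoint β U (μ + U / 2) L 0 0 1 1 - d‖ ≤ |U| * (ε / (2 * (|U| + 1))) :=
            mul_le_mul_of_nonneg_left hdL (abs_nonneg U)
        _ ≤ (|U| + 1) * (ε / (2 * (|U| + 1))) := mul_le_mul_of_nonneg_right (le_add_of_nonneg_right zero_le_one) (by positivity)
        _ = ε / 2 := by field_simp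
    · rw [if_neg (fun h0 => hz (hind.1 h0)), if_neg hz, sub_zero, norm_zero]; positivity
  -- pair part
  have hPp : ‖(U : ℂ) ^ 2 * (∫ τ in (0 : ℝ)..β, cexp (I * ((Real.pi * (2 * (n : ℝ) + 1) / β : ℝ) : ℂ) * τ) *
          gibbsState β (hubbardTorusWith 2 L 1 U (μ + U / 2))
            (imagTimeEvolve (hubbardTorusWith 2 L 1 U (μ + U / 2)) (τ : ℂ)
              (annihilation (orb (FermionTorus.ofTorusSite (0 : TorusSite 2 L)) 0) * numberOp (FermionTorus.ofTorusSite (0 : TorusSite 2 L)) 1 -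
                (1 / 2 : ℂ) • annihilation (orb (FermionTorus.ofTorusSite (0 : TorusSite 2 L)) 0)) *
              (annihilation (orb (FermionTorus.ofTorusSite (Torus.proj L z)) 0) * numberOp (FermionTorus.ofTorusSite (Torus.proj L z)) 1 -
                (1 / 2 : ℂ) • annihilation (orb (FermionTorus.ofTorusSite (Torus.proj L z)) 0))ᴴ)) - (U : ℂ) ^ 2 * h‖ ≤ ε / 2 := by
    rw [← mul_sub, norm_mul, norm_pow, Complex.norm_real, Real.norm_eq_abs, sq_abs]
    calc U ^ 2 * _ ≤ U ^ 2 * (ε / (2 * (U ^ 2 + 1))) := mul_le_mul_of_nonneg_left hpL (sq_nonneg U)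
      _ ≤ (U ^ 2 + 1) * (ε / (2 * (U ^ 2 + 1))) := mul_le_mul_of_nonneg_right (le_add_of_nonneg_right zero_le_one) (by positivity)
      _ = ε / 2 := by field_simp
  calc _ ≤ ‖(if Torus.proj L z = 0 then (U : ℂ) * klOccInf L β U μ else 0) - (if z = 0 then (U : ℂ) * (d - 1 / 2) else 0)‖ +
        ‖(U : ℂ) ^ 2 * (∫ τ in (0 : ℝ)..β, cexp (I * ((Real.pi * (2 * (n : ℝ) + 1) / β : ℝ) : ℂ) * τ) *
          gibbsState β (hubbardTorusWith 2 L 1 U (μ + U / 2))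
            (imagTimeEvolve (hubbardTorusWith 2 L 1 U (μ + U / 2)) (τ : ℂ)
              (annihilation (orb (FermionTorus.ofTorusSite (0 : TorusSite 2 L)) 0) * numberOp (FermionTorus.ofTorusSite (0 : TorusSite 2 L)) 1 -
                (1 / 2 : ℂ) • annihilation (orb (FermionTorus.ofTorusSite (0 : TorusSite 2 L)) 0)) *
              (annihilation (orb (FermionTorus.ofTorusSite (Torus.proj L z)) 0) * numberOp (FermionTorus.ofTorusSite (Torus.proj L z)) 1 -
                (1 / 2 : ℂ) • annihilation (orb (FermionTorus.ofTorusSite (Torus.proj L z)) 0))ᴴ)) - (U : ℂ) ^ 2 * h‖ := by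
        refine le_trans (le_of_eq ?_) (norm_sub_le _ _)
        congr 1; ring
    _ ≤ ε / 2 + ε / 2 := add_le_add hH hPp
    _ = ε := by ring

/-! ## §4 The doors in Gibbs currency -/

/-- **A VL child (any `Pr`, `W`) FROM THE THERMODYNAMIC LIMIT OF THE TORUS GIBBS STATE AT FINITELY MANY LOCAL OBSERVABLES**: inside the regime binders,
(G-dens) the density `⟨c†_{0↓}c_{0↓}⟩_{β,U,μ+U/2,L}` converges as `L → ∞`, and (G-pair) for each Matsubara integer `n` and lattice offset `z ∈ ℤ²` the Matsubara
coefficient `∫₀^β e^{iω_nτ}⟨τ_τ(A_0)A_{proj_L z}†⟩_{β,H_L} dτ`, `A_x = c_{x↑}n_{x↓} − ½c_{x↑}`, `H_L = hubbardTorusWith 2 L 1 U (μ + U/2)`, converges as `L → ∞`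
(ε-forms; any limits, any speed). -/
theorem volumeLimitP2_of_gibbsLimitText (Pr : Preds) (W : Set ℝ)
    (hPr : ∀ (R : RenConsts) (U : ℝ) (N : ℕ) (μ : ℝ) (K : TrigPolyC4v), Pr.frameOK R U N μ K → FrameOK R U N μ K)
    (hG : ∀ (G : GeoConsts) (P : SplitConsts) (Q : EngConsts) (R : RenConsts), G.WF → P.WF → Q.WF → R.WF →
      ∃ c₅ : ℝ, 0 < c₅ ∧ ∀ c : ℝ, 0 < c → c ≤ c₅ → ∃ U₀ : ℝ, 0 < U₀ ∧
        ∀ μ ∈ W, ∀ U : ℝ, 0 < U → U ≤ U₀ → ∀ β : ℝ, klBetaMin ≤ β → β ≤ Real.exp (c / U ^ 2) →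
          ∀ K : TrigPolyC4v, Pr.frameOK R U (nScales β) μ K →
            ∀ (Lstar : ℕ) (Mstar : ℕ → ℕ), TowerP Pr G P Q R β U μ K Lstar Mstar →
              (∃ d : ℂ, ∀ ε > (0 : ℝ), ∃ L₁ : ℕ, ∀ (L : ℕ) [NeZero L], L₁ ≤ L →
                  ‖hubbardThermalTwoPoint β U (μ + U / 2) L 0 0 1 1 - d‖ ≤ ε) ∧
              ∀ (n : ℤ) (z : Site 2), ∃ h : ℂ, ∀ ε > (0 : ℝ), ∃ L₁ : ℕ, ∀ (L : ℕ) [NeZero L], L₁ ≤ L →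
                ‖(∫ τ in (0 : ℝ)..β, cexp (I * ((Real.pi * (2 * (n : ℝ) + 1) / β : ℝ) : ℂ) * τ) *
                    gibbsState β (hubbardTorusWith 2 L 1 U (μ + U / 2))
                      (imagTimeEvolve (hubbardTorusWith 2 L 1 U (μ + U / 2)) (τ : ℂ)
                        (annihilation (orb (FermionTorus.ofTorusSite (0 : TorusSite 2 L)) 0) *
                            numberOp (FermionTorus.ofTorusSite (0 : TorusSite 2 L)) 1 -
                          (1 / 2 : ℂ) • annihilation (orb (FermionTorus.ofTorusSite (0 : TorusSite 2 L)) 0)) *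
                        (annihilation (orb (FermionTorus.ofTorusSite (Torus.proj L z)) 0) *
                            numberOp (FermionTorus.ofTorusSite (Torus.proj L z)) 1 -
                          (1 / 2 : ℂ) • annihilation (orb (FermionTorus.ofTorusSite (Torus.proj L z)) 0))ᴴ)) - h‖ ≤ ε) :
    VolumeLimitP2 Pr FinalTwoLegVolLimitEx W := by
  refine volumeLimitP2_of_perSiteLimitText Pr W hPr ?_
  intro G P Q R hGw hP hQ hR
  obtain ⟨c₅, hc₅, hc⟩ := hG G P Q R hGw hP hQ hR
  refine ⟨c₅, hc₅, fun c hc0 hcc => ?_⟩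
  obtain ⟨U₀, hU₀, hU⟩ := hc c hc0 hcc
  refine ⟨U₀, hU₀, fun μ hμ U hU0 hUU β hβmin hβmax K hK Lstar Mstar hT n z => ?_⟩
  obtain ⟨hd, hp⟩ := hU μ hμ U hU0 hUU β hβmin hβmax K hK Lstar Mstar hT
  exact perSite_limit_of_gibbs_limits (pos_of_klBetaMin_le hβmin) hU0.ne' μ n z hd (hp n z)

end Summit.HubbardSuperconductivity.HubbardSuperconductivity.Theorems.TwoPointAssembly

end
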